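import Summits.QuantumFields.YangMills.Theorems.UnitScaleTiltHalvingP1FlatCoreFrameLinLipschitz
import Summits.QuantumFields.YangMills.Theorems.UnitScaleTiltHalvingP1FlatCoreFrameLinLocal
import HarnessLib

/-!
# The effective-gauge tower in log coordinates — LOCAL form of the Lipschitz row (1.125) (J-N05♭ `core′`, F3-local)

Sub-problem `YangMills` of summit `QuantumFields`; route `UnitScaleTilt`, line H = `BirthV10.stub_halvingStep`, pillar P1♭ `core′`
(LEAD-H T2♭-PLAN v1.1; rulings L-3/L-4/L-5).  Helper file (`--supports stmt-QuantumFields-19200 --as helper`); it closes no item.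
HONEST LABEL: YM₃ on `T³` is rung R3 of the ladder, NOT the Clay problem; nothing here is a mass-gap statement.

## What this file adds

The companion of ✓`P1FlatCoreFrameLinLocal` (the LOCAL size row): ✓`P1FlatCoreFrameLinLipschitz.norm_Cnl_sub_Cnl_le` asks its
hypotheses at every site; the family contraction's `hC125` (✓`B8SectEKLevelFamilyHc`) supplies them only on the (1.120)-box of the
tower under the evaluation site.  Here every hypothesis is asked on a
user-supplied family of site sets `S j ⊆ T^{(j)}` closed under «centre and stair ends of a block of `S (j+1)` lie in `S j`», and the
conclusions hold at `y ∈ S k`:  §1 `analyticAt_effGauge_line_local`, the pointwise disc supplier `norm_stairRel_sub_one_lt_one_pt`;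
§0 locality (`effGauge_congr_local`, `siteAvgIter_congr_local`); §2 ★★★ `norm_Cnl_sub_Cnl_le_local` (Lipschitz row, `0 ≤ n ≤ r/4`).

[cite: Balaban1985RegularSpaces, Sect. E (1.120)-(1.125) pp.95-97; Balaban1985Averaging, (97)-(100) p.32, (110) p.34]
-/

noncomputable section

open NormedSpace Metric
open Literature.MathematicalPhysics.QuantumFieldTheory.Balaban1983to89
open T4Continuum BlockAveraging ExpMeanLog MatrixLog
open B10Eq27TorusAxialLog (holT gaugeActT)
open B7TransferAnalyticMean (meanCLM meanCLM_apply norm_meanCLM_apply_le)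
open B12Membership313II (bchLog exp_bchLog norm_expMul_sub_one_lt_one)
open BlockAveragingEMLAnalyticMean (eml_eq_exp_meanCLM)
open B7Prop1Explicit (units_val_inv_eq_exp_neg)
open LatticeFieldCalculus (siteAvg siteAvgIter)
open Summit.QuantumFields.YangMills.Theorems.Prop8ChartDoubleBar (vframeU dbarIterU)
open Summit.QuantumFields.YangMills.Theorems.P1FlatCoreFrameLinBCH (norm_meanCLM_le_of_forall_le)
open Summit.QuantumFields.YangMills.Theorems.P1FlatCoreFrameLin (coe_vframeU_eq_exp_meanCLM)
open Summit.QuantumFields.YangMills.Theorems.P1FlatCoreFrameLinTower (effGauge_step_eq_eml)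
open Summit.QuantumFields.YangMills.Theorems.P1FlatCoreFrameLinOsc (norm_bchLog_le_two_mul)
open Summit.QuantumFields.YangMills.Theorems.P1FlatCoreFrameLinLipschitz (norm_sub_le_of_bound_on_ball siteAvgIter_add_smul val_unit_eml
  val_inv_unit_eml analyticAt_meanCLM_family)
open Summit.QuantumFields.YangMills.Theorems.P1FlatCoreFrameLinLocal (norm_siteAvgIter_le_local
  exp_mlog_and_norm_mlog_effGauge_sub_siteAvgIter_le_local)

namespace Summit.QuantumFields.YangMills.Theorems.P1FlatCoreFrameLinLipschitzLocal


/-! ## §0 Locality: the tower and the linear part on `S` only read the data on `S` -/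

section Congr

variable {𝔸 : Type*} [NormedRing 𝔸] [NormedAlgebra ℂ 𝔸] [CompleteSpace 𝔸]
variable {P : Params}

open Summit.QuantumFields.YangMills.Theorems.P1FlatCoreFrameLinTower (coe_vframeU_gaugeActT_eq_conj_eml)
open Summit.QuantumFields.YangMills.Theorems.P1FlatCoreFrameLin (meanCLM_stairEnd_eq_siteAvg)

/-- **LOCALITY OF THE TOWER**: two bottom gauges that agree on `S 0` have towers that agree on every `S j`, `j ≤ k` (each step reads the
centre and the stair ends of the block, ✓`coe_vframeU_gaugeActT_eq_conj_eml`). [cite: Balaban1985Averaging, (97)-(100) p.32, (110) p.34] -/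
theorem effGauge_congr_local (W : GaugeField P 0 𝔸ˣ) (κf : (Site P 0 → 𝔸) → (i : ℕ) → GaugeTransf P i 𝔸ˣ)
    (hs : ∀ (m : Site P 0 → 𝔸) (i : ℕ) (y : Site P (i + 1)),
      κf m (i + 1) y = (vframeU (gaugeActT (κf m i) (dbarIterU i W)) y)⁻¹ * κf m i (emb y) * vframeU (dbarIterU i W) y)
    (h0 : ∀ (m : Site P 0 → 𝔸) (x : Site P 0), ((κf m 0 x : 𝔸ˣ) : 𝔸) = exp (m x))
    (μ₁ μ₂ : Site P 0 → 𝔸) (k : ℕ) (S : (j : ℕ) → Set (Site P j))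
    (hSe : ∀ j < k, ∀ y ∈ S (j + 1), emb y ∈ S j)
    (hSs : ∀ j < k, ∀ y ∈ S (j + 1), ∀ idx : Idx P, walkEnd (emb y) (stairWord idx.2.1 (off idx.1)) ∈ S j)
    (hμ : ∀ x ∈ S 0, μ₁ x = μ₂ x) : ∀ j ≤ k, ∀ x ∈ S j, κf μ₁ j x = κf μ₂ j x := by
  intro j
  induction j with
  | zero => intro _ x hx; exact Units.ext (by rw [h0, h0, hμ x hx])
  | succ j ih =>
    intro hjk y hy
    have hj : j < k := Nat.lt_of_succ_le hjk
    have ihj := ih hj.le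
    have hv : vframeU (gaugeActT (κf μ₁ j) (dbarIterU j W)) y = vframeU (gaugeActT (κf μ₂ j) (dbarIterU j W)) y := by
      apply Units.ext
      rw [coe_vframeU_gaugeActT_eq_conj_eml, coe_vframeU_gaugeActT_eq_conj_eml, ihj _ (hSe j hj y hy)]
      congr 2
      exact congrArg eml (funext fun idx => by rw [ihj _ (hSs j hj y hy idx)])
    rw [hs μ₁ j y, hs μ₂ j y, hv, ihj _ (hSe j hj y hy)]

omit [CompleteSpace 𝔸] in
/-- **LOCALITY OF THE LINEAR PART**: two fields that agree on `S 0` have iterated site-averages that agree on every `S j`, `j ≤ k`.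
[cite: Balaban1984PropagatorsI, (1.20) p.20] -/
theorem siteAvgIter_congr_local (f g : Site P 0 → 𝔸) (k : ℕ) (S : (j : ℕ) → Set (Site P j))
    (hSs : ∀ j < k, ∀ y ∈ S (j + 1), ∀ idx : Idx P, walkEnd (emb y) (stairWord idx.2.1 (off idx.1)) ∈ S j)
    (hfg : ∀ x ∈ S 0, f x = g x) : ∀ j ≤ k, ∀ y ∈ S j, siteAvgIter j f y = siteAvgIter j g y := by
  intro j
  induction j with
  | zero => intro _ y hy; exact hfg y hy
  | succ j ih =>
    intro hjk y hy
    have hj : j < k := Nat.lt_of_succ_le hjk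
    show siteAvg (siteAvgIter j f) y = siteAvg (siteAvgIter j g) y
    rw [← meanCLM_stairEnd_eq_siteAvg, ← meanCLM_stairEnd_eq_siteAvg]
    congr 1
    funext idx
    exact ih hj.le _ (hSs j hj y hy idx)

end Congr

/-! ## §1 Analyticity of the tower along a complex line, with the disc condition on `S` -/

section Analytic

variable {𝔸 : Type*} [NormedRing 𝔸] [NormedAlgebra ℂ 𝔸] [CompleteSpace 𝔸]
variable {P : Params}

/-- **★ THE TOWER ALONG A COMPLEX LINE IS ANALYTIC ON `S`** (✓`analyticAt_effGauge_line` with the disc condition asked only for blocks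
in `S (i+1)` and the conclusion at sites of `S i`). [cite: Balaban1985RegularSpaces, Sect. E pp.96-97; Balaban1985Averaging, (97)-(100) p.32] -/
theorem analyticAt_effGauge_line_local (W : GaugeField P 0 𝔸ˣ) (κf : (Site P 0 → 𝔸) → (i : ℕ) → GaugeTransf P i 𝔸ˣ)
    (hs : ∀ (m : Site P 0 → 𝔸) (i : ℕ) (y : Site P (i + 1)),
      κf m (i + 1) y = (vframeU (gaugeActT (κf m i) (dbarIterU i W)) y)⁻¹ * κf m i (emb y) * vframeU (dbarIterU i W) y)
    (h0 : ∀ (m : Site P 0 → 𝔸) (x : Site P 0), ((κf m 0 x : 𝔸ˣ) : 𝔸) = exp (m x))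
    (μ ν : Site P 0 → 𝔸) (τ₀ : ℂ) (k : ℕ) (S : (j : ℕ) → Set (Site P j))
    (hSe : ∀ j < k, ∀ y ∈ S (j + 1), emb y ∈ S j)
    (hSs : ∀ j < k, ∀ y ∈ S (j + 1), ∀ idx : Idx P, walkEnd (emb y) (stairWord idx.2.1 (off idx.1)) ∈ S j)
    (hdisc : ∀ i < k, ∀ y ∈ S (i + 1), ∀ idx : Idx P,
      ‖((holT (dbarIterU i W) (emb y) (stairWord idx.2.1 (off idx.1)) : 𝔸ˣ) : 𝔸) *
          (((κf (μ + τ₀ • ν) i (walkEnd (emb y) (stairWord idx.2.1 (off idx.1))))⁻¹ * κf (μ + τ₀ • ν) i (emb y) : 𝔸ˣ) : 𝔸) - 1‖ < 1) :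
    ∀ i ≤ k, ∀ x ∈ S i, AnalyticAt ℂ (fun τ : ℂ => ((κf (μ + τ • ν) i x : 𝔸ˣ) : 𝔸)) τ₀ ∧
      AnalyticAt ℂ (fun τ : ℂ => (((κf (μ + τ • ν) i x)⁻¹ : 𝔸ˣ) : 𝔸)) τ₀ := by
  intro i
  induction i with
  | zero =>
    intro _ x _
    have hlin : AnalyticAt ℂ (fun τ : ℂ => μ x + τ • ν x) τ₀ := analyticAt_const.add (analyticAt_id.smul analyticAt_const)
    have hval : (fun τ : ℂ => ((κf (μ + τ • ν) 0 x : 𝔸ˣ) : 𝔸)) = fun τ => exp (μ x + τ • ν x) := by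
      funext τ; rw [h0]; rfl
    have hinv : (fun τ : ℂ => (((κf (μ + τ • ν) 0 x)⁻¹ : 𝔸ˣ) : 𝔸)) = fun τ => exp (-(μ x + τ • ν x)) := by
      funext τ; exact units_val_inv_eq_exp_neg (by rw [h0]; rfl)
    rw [hval, hinv]
    exact ⟨(exp_analytic _).fun_comp_of_eq hlin rfl, (exp_analytic _).fun_comp_of_eq hlin.neg rfl⟩
  | succ i ih =>
    intro hik y hy
    have hi : i < k := Nat.lt_of_succ_le hik
    have ihi := ih hi.le
    have hye : emb y ∈ S i := hSe i hi y hy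
    have hys : ∀ idx : Idx P, walkEnd (emb y) (stairWord idx.2.1 (off idx.1)) ∈ S i := hSs i hi y hy
    -- the family `hol·s` along the line and the mean of its logarithms
    have hfam : ∀ idx : Idx P, AnalyticAt ℂ (fun τ : ℂ =>
        ((holT (dbarIterU i W) (emb y) (stairWord idx.2.1 (off idx.1)) : 𝔸ˣ) : 𝔸) *
          (((κf (μ + τ • ν) i (walkEnd (emb y) (stairWord idx.2.1 (off idx.1))))⁻¹ * κf (μ + τ • ν) i (emb y) : 𝔸ˣ) : 𝔸)) τ₀ := by
      intro idx
      simp only [Units.val_mul]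
      exact analyticAt_const.fun_mul ((ihi _ (hys idx)).2.fun_mul (ihi _ hye).1)
    have hM : AnalyticAt ℂ (fun τ : ℂ => meanCLM (Idx P) 𝔸 fun idx : Idx P =>
        mlog (((holT (dbarIterU i W) (emb y) (stairWord idx.2.1 (off idx.1)) : 𝔸ˣ) : 𝔸) *
          (((κf (μ + τ • ν) i (walkEnd (emb y) (stairWord idx.2.1 (off idx.1))))⁻¹ * κf (μ + τ • ν) i (emb y) : 𝔸ˣ) : 𝔸))) τ₀ :=
      analyticAt_meanCLM_family fun idx => (MatrixLog.analyticAt_mlog (hdisc i hi y hy idx)).fun_comp_of_eq (hfam idx) rfl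
    -- the step as a product of three analytic factors
    have hval : (fun τ : ℂ => ((κf (μ + τ • ν) (i + 1) y : 𝔸ˣ) : 𝔸)) = fun τ =>
        ((κf (μ + τ • ν) i (emb y) : 𝔸ˣ) : 𝔸) *
          exp (-(meanCLM (Idx P) 𝔸 fun idx : Idx P =>
            mlog (((holT (dbarIterU i W) (emb y) (stairWord idx.2.1 (off idx.1)) : 𝔸ˣ) : 𝔸) *
              (((κf (μ + τ • ν) i (walkEnd (emb y) (stairWord idx.2.1 (off idx.1))))⁻¹ * κf (μ + τ • ν) i (emb y) : 𝔸ˣ) : 𝔸)))) *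
          ((vframeU (dbarIterU i W) y : 𝔸ˣ) : 𝔸) := by
      funext τ
      rw [effGauge_step_eq_eml W (κf (μ + τ • ν)) (hs (μ + τ • ν)) i y, Units.val_mul, Units.val_mul, val_inv_unit_eml]
    have hinv : (fun τ : ℂ => (((κf (μ + τ • ν) (i + 1) y)⁻¹ : 𝔸ˣ) : 𝔸)) = fun τ =>
        (((vframeU (dbarIterU i W) y)⁻¹ : 𝔸ˣ) : 𝔸) *
          exp (meanCLM (Idx P) 𝔸 fun idx : Idx P =>
            mlog (((holT (dbarIterU i W) (emb y) (stairWord idx.2.1 (off idx.1)) : 𝔸ˣ) : 𝔸) *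
              (((κf (μ + τ • ν) i (walkEnd (emb y) (stairWord idx.2.1 (off idx.1))))⁻¹ * κf (μ + τ • ν) i (emb y) : 𝔸ˣ) : 𝔸))) *
          (((κf (μ + τ • ν) i (emb y))⁻¹ : 𝔸ˣ) : 𝔸) := by
      funext τ
      rw [effGauge_step_eq_eml W (κf (μ + τ • ν)) (hs (μ + τ • ν)) i y, mul_inv_rev, mul_inv_rev, inv_inv, Units.val_mul,
        Units.val_mul, val_unit_eml, mul_assoc]
    rw [hval, hinv]
    exact ⟨((ihi _ hye).1.fun_mul ((exp_analytic _).fun_comp_of_eq hM.neg rfl)).fun_mul analyticAt_const,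
      (analyticAt_const.fun_mul ((exp_analytic _).fun_comp_of_eq hM rfl)).fun_mul (ihi _ hye).2⟩


/-- **THE DISC CONDITION, POINTWISE**: `κ = e^{l}` at the two sites `x`, `z` with `‖l‖ ≤ a″` there, stair `hol` within `δ ≤ 1/2` of `1`,
`2δ + 4a″ ≤ 1/4` ⇒ `‖hol·κ(x)⁻¹κ(z) − 1‖ < 1` (✓`norm_stairRel_sub_one_lt_one` with `hκ` only where it is used).
[cite: Balaban1985Averaging, (21) p.21, (110) p.34] -/
theorem norm_stairRel_sub_one_lt_one_pt {j : ℕ} (hol : 𝔸ˣ) (κ : GaugeTransf P j 𝔸ˣ) (l : Site P j → 𝔸) (x z : Site P j)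
    (hκx : ((κ x : 𝔸ˣ) : 𝔸) = exp (l x)) (hκz : ((κ z : 𝔸ˣ) : 𝔸) = exp (l z)) {δ a'' : ℝ} (hH : ‖(hol : 𝔸) - 1‖ ≤ δ)
    (hx : ‖l x‖ ≤ a'') (hz : ‖l z‖ ≤ a'') (hδ : δ ≤ 1 / 2) (hr : 2 * δ + 4 * a'' ≤ 1 / 4) :
    ‖(hol : 𝔸) * ((((κ x)⁻¹ * κ z) : 𝔸ˣ) : 𝔸) - 1‖ < 1 := by
  have ha : 0 ≤ a'' := (norm_nonneg _).trans hx
  have hδ0 : 0 ≤ δ := (norm_nonneg _).trans hH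
  have h1 : ‖(hol : 𝔸) - 1‖ < 1 := hH.trans_lt (by linarith)
  have hHn : ‖mlog (hol : 𝔸)‖ ≤ 2 * δ := (norm_mlog_le_two_mul (hH.trans hδ)).trans (by linarith)
  have hrel : ((((κ x)⁻¹ * κ z) : 𝔸ˣ) : 𝔸) = exp (-(l x)) * exp (l z) := by
    rw [Units.val_mul, units_val_inv_eq_exp_neg hκx, hκz]
  have h2 : ‖-(l x)‖ + ‖l z‖ ≤ 1 / 4 := by rw [norm_neg]; linarith
  have hSn : ‖bchLog (-(l x)) (l z)‖ ≤ 2 * (a'' + a'') := norm_bchLog_le_two_mul (by rwa [norm_neg]) hz (by linarith)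
  rw [hrel, ← exp_bchLog (norm_expMul_sub_one_lt_one h2)]
  conv_lhs => rw [← exp_mlog h1]
  exact norm_expMul_sub_one_lt_one (by linarith)

end Analytic

/-! ## §2 The Lipschitz row (1.125), LOCAL -/

section Lipschitz

variable {𝔸 : Type*} [NormedRing 𝔸] [NormedAlgebra ℂ 𝔸] [CompleteSpace 𝔸]
variable {P : Params}

/-- **★★★ THE `k`-UNIFORM LIPSCHITZ ROW (1.125), LOCAL** (✓`norm_Cnl_sub_Cnl_le` with every hypothesis — sizes of `μ`, `ν`, stairs,
linear oscillations — asked only on a stair-closed family `S` of site sets, `0 ≤ n ≤ r/4`, conclusion at `y ∈ S k`; `n = 0` by §0):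
`‖C(μ + ν) − C(μ)‖ ≤ 2·M·n/r`, `M := 640(a + r + δ + 5(ω + r))(ω + r)`, `C(m) := log κf(m)_k(y) − (Q′_k m)(y)`.
[cite: Balaban1985RegularSpaces, Sect. E (1.122)-(1.125) pp.96-97] -/
theorem norm_Cnl_sub_Cnl_le_local [Nonempty (Idx P)] (W : GaugeField P 0 𝔸ˣ) (κf : (Site P 0 → 𝔸) → (i : ℕ) → GaugeTransf P i 𝔸ˣ)
    (hs : ∀ (m : Site P 0 → 𝔸) (i : ℕ) (y : Site P (i + 1)),
      κf m (i + 1) y = (vframeU (gaugeActT (κf m i) (dbarIterU i W)) y)⁻¹ * κf m i (emb y) * vframeU (dbarIterU i W) y)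
    (h0 : ∀ (m : Site P 0 → 𝔸) (x : Site P 0), ((κf m 0 x : 𝔸ˣ) : 𝔸) = exp (m x))
    {a δ ω n r : ℝ} (ha0 : 0 ≤ a) (hδ : 0 ≤ δ) (hω : 0 ≤ ω) (hn : 0 ≤ n) (hr0 : 0 < r) (hnr : n ≤ r / 4) (k : ℕ)
    (S : (j : ℕ) → Set (Site P j)) (hSe : ∀ j < k, ∀ y ∈ S (j + 1), emb y ∈ S j)
    (hSs : ∀ j < k, ∀ y ∈ S (j + 1), ∀ idx : Idx P, walkEnd (emb y) (stairWord idx.2.1 (off idx.1)) ∈ S j)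
    (hH : ∀ j < k, ∀ y ∈ S (j + 1), ∀ idx : Idx P,
      ‖((holT (dbarIterU j W) (emb y) (stairWord idx.2.1 (off idx.1)) : 𝔸ˣ) : 𝔸) - 1‖ ≤ δ)
    (μ ν : Site P 0 → 𝔸) (ha : ∀ x ∈ S 0, ‖μ x‖ ≤ a) (hνn : ∀ x ∈ S 0, ‖ν x‖ ≤ n)
    (hosc : ∀ j < k, ∀ y ∈ S (j + 1), ∀ idx : Idx P,
      ‖siteAvgIter j μ (walkEnd (emb y) (stairWord idx.2.1 (off idx.1))) - siteAvgIter j μ (emb y)‖ ≤ ω * 2 ^ (j + 1) / 2 ^ k)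
    (hνosc : ∀ j < k, ∀ y ∈ S (j + 1), ∀ idx : Idx P,
      ‖siteAvgIter j ν (walkEnd (emb y) (stairWord idx.2.1 (off idx.1))) - siteAvgIter j ν (emb y)‖ ≤ n * 2 ^ (j + 1) / 2 ^ k)
    (hr : 160 * (a + r + δ + 5 * (ω + r)) ≤ 1 / 4) (y : Site P k) (hy : y ∈ S k) :
    ‖(mlog ((κf (μ + ν) k y : 𝔸ˣ) : 𝔸) - siteAvgIter k (μ + ν) y) - (mlog ((κf μ k y : 𝔸ˣ) : 𝔸) - siteAvgIter k μ y)‖ ≤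
      2 * (640 * (a + r + δ + 5 * (ω + r)) * (ω + r)) * n / r := by
  set M : ℝ := 640 * (a + r + δ + 5 * (ω + r)) * (ω + r) with hMdef
  have hM0 : 0 ≤ M := by positivity
  -- the trivial case `n = 0`: `μ + ν = μ` on `S 0`, so both towers and both linear parts agree at `y` (§0)
  rcases hn.eq_or_lt with hn0 | hnpos
  · have hν : ∀ x ∈ S 0, (μ + ν) x = μ x := fun x hx => by
      have h := hνn x hx
      rw [← hn0] at h
      rw [Pi.add_apply, norm_le_zero_iff.mp h, add_zero]
    rw [effGauge_congr_local W κf hs h0 (μ + ν) μ k S hSe hSs hν k le_rfl y hy,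
      siteAvgIter_congr_local (μ + ν) μ k S hSs hν k le_rfl y hy, sub_self, norm_zero, ← hn0]
    positivity
  -- the function along the line and its value bound on the ball of radius `R = r/n`
  set R : ℝ := r / n with hR
  have hRpos : 0 < R := by positivity
  set g : ℂ → 𝔸 := fun τ => mlog ((κf (μ + τ • ν) k y : 𝔸ˣ) : 𝔸) - siteAvgIter k (μ + τ • ν) y with hg
  have hline : ∀ τ : ℂ, ‖τ‖ < R →
      (∀ x ∈ S 0, ‖(μ + τ • ν) x‖ ≤ a + r) ∧
      (∀ j < k, ∀ y ∈ S (j + 1), ∀ idx : Idx P,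
        ‖siteAvgIter j (μ + τ • ν) (walkEnd (emb y) (stairWord idx.2.1 (off idx.1))) - siteAvgIter j (μ + τ • ν) (emb y)‖ ≤
          (ω + r) * 2 ^ (j + 1) / 2 ^ k) := by
    intro τ hτ
    have hτn : ‖τ‖ * n ≤ r := by
      rw [hR, lt_div_iff₀ hnpos] at hτ; exact hτ.le
    refine ⟨fun x hx => ?_, fun j hj y' hy' idx => ?_⟩
    · calc ‖(μ + τ • ν) x‖ = ‖μ x + τ • ν x‖ := rfl
        _ ≤ ‖μ x‖ + ‖τ‖ * ‖ν x‖ := (norm_add_le _ _).trans (by rw [norm_smul])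
        _ ≤ a + ‖τ‖ * n := add_le_add (ha x hx) (mul_le_mul_of_nonneg_left (hνn x hx) (norm_nonneg _))
        _ ≤ a + r := by linarith
    · rw [siteAvgIter_add_smul μ ν τ j]
      simp only [Pi.add_apply, Pi.smul_apply]
      have e1 := hosc j hj y' hy' idx
      have e2 := hνosc j hj y' hy' idx
      have h2k : (0 : ℝ) ≤ 2 ^ (j + 1) / 2 ^ k := by positivity
      calc _ = ‖(siteAvgIter j μ (walkEnd (emb y') (stairWord idx.2.1 (off idx.1))) - siteAvgIter j μ (emb y')) +
            τ • (siteAvgIter j ν (walkEnd (emb y') (stairWord idx.2.1 (off idx.1))) - siteAvgIter j ν (emb y'))‖ := by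
              congr 1; rw [smul_sub]; abel
        _ ≤ ω * 2 ^ (j + 1) / 2 ^ k + ‖τ‖ * (n * 2 ^ (j + 1) / 2 ^ k) :=
            (norm_add_le _ _).trans (add_le_add e1 (by rw [norm_smul]; exact mul_le_mul_of_nonneg_left e2 (norm_nonneg _)))
        _ ≤ (ω + r) * 2 ^ (j + 1) / 2 ^ k := by
            have : ‖τ‖ * (n * 2 ^ (j + 1) / 2 ^ k) = (‖τ‖ * n) * (2 ^ (j + 1) / 2 ^ k) := by ring
            rw [this, mul_div_assoc, mul_div_assoc, add_mul]
            linarith [mul_le_mul_of_nonneg_right hτn h2k]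
  have hωr : 0 ≤ ω + r := by positivity
  have hrk : 160 * ((a + r) + δ + 5 * (ω + r)) ≤ 1 / 4 := by linarith
  -- the size row on the ball: every level is `exp ∘ log`, and the value bound `‖g τ‖ ≤ M`
  have har : 0 ≤ a + r := by positivity
  have htower : ∀ τ : ℂ, ‖τ‖ < R → ∀ j ≤ k, ∀ x ∈ S j,
      exp (mlog ((κf (μ + τ • ν) j x : 𝔸ˣ) : 𝔸)) = ((κf (μ + τ • ν) j x : 𝔸ˣ) : 𝔸) ∧
        ‖mlog ((κf (μ + τ • ν) j x : 𝔸ˣ) : 𝔸) - siteAvgIter j (μ + τ • ν) x‖ ≤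
          4 * (160 * ((a + r) + δ + 5 * (ω + r))) * (ω + r) * (2 ^ j / 2 ^ k) := fun τ hτ =>
    exp_mlog_and_norm_mlog_effGauge_sub_siteAvgIter_le_local W (κf (μ + τ • ν)) (hs _) (μ + τ • ν) (h0 _) har hδ hωr k S hSe hSs
      (hline τ hτ).1 hH (hline τ hτ).2 hrk
  have hbound : ∀ τ ∈ ball (0 : ℂ) R, ‖g τ‖ ≤ M := by
    intro τ hτ
    rw [mem_ball, dist_zero_right] at hτ
    have h := (htower τ hτ k le_rfl y hy).2
    have h2k : (2 : ℝ) ^ k / 2 ^ k = 1 := div_self (by positivity)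
    rw [h2k, mul_one] at h
    exact h.trans (le_of_eq (by rw [hMdef]; ring))
  -- differentiability of `g` on the ball: analyticity of the tower (§3) and of the linear part
  have hdiff : DifferentiableOn ℂ g (ball (0 : ℂ) R) := by
    intro τ₀ hτ₀
    rw [mem_ball, dist_zero_right] at hτ₀
    have hsize : ∀ j ≤ k, ∀ x ∈ S j, ‖mlog ((κf (μ + τ₀ • ν) j x : 𝔸ˣ) : 𝔸)‖ ≤ (a + r) + (ω + r) := by
      intro j hj x hx
      have h := (htower τ₀ hτ₀ j hj x hx).2
      have hQ : ‖siteAvgIter j (μ + τ₀ • ν) x‖ ≤ a + r :=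
        norm_siteAvgIter_le_local _ har k S hSs (hline τ₀ hτ₀).1 j hj x hx
      have hjk : (2 : ℝ) ^ j / 2 ^ k ≤ 1 := by
        rw [div_le_one (by positivity)]; exact pow_le_pow_right₀ (by norm_num) hj
      have h4 : 4 * (160 * ((a + r) + δ + 5 * (ω + r))) * (ω + r) * (2 ^ j / 2 ^ k) ≤ ω + r := by
        have : 4 * (160 * ((a + r) + δ + 5 * (ω + r))) * (ω + r) * (2 ^ j / 2 ^ k) ≤
            4 * (160 * ((a + r) + δ + 5 * (ω + r))) * (ω + r) * 1 :=
          mul_le_mul_of_nonneg_left hjk (by positivity)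
        nlinarith
      calc _ = ‖(mlog ((κf (μ + τ₀ • ν) j x : 𝔸ˣ) : 𝔸) - siteAvgIter j (μ + τ₀ • ν) x) + siteAvgIter j (μ + τ₀ • ν) x‖ := by
            rw [sub_add_cancel]
        _ ≤ (ω + r) + (a + r) := (norm_add_le _ _).trans (add_le_add (h.trans h4) hQ)
        _ = (a + r) + (ω + r) := add_comm _ _
    have hdisc : ∀ i < k, ∀ y' ∈ S (i + 1), ∀ idx : Idx P,
        ‖((holT (dbarIterU i W) (emb y') (stairWord idx.2.1 (off idx.1)) : 𝔸ˣ) : 𝔸) *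
            (((κf (μ + τ₀ • ν) i (walkEnd (emb y') (stairWord idx.2.1 (off idx.1))))⁻¹ * κf (μ + τ₀ • ν) i (emb y') : 𝔸ˣ) : 𝔸) -
              1‖ < 1 := by
      intro i hi y' hy' idx
      exact norm_stairRel_sub_one_lt_one_pt _ (κf (μ + τ₀ • ν) i) (fun x => mlog ((κf (μ + τ₀ • ν) i x : 𝔸ˣ) : 𝔸)) _ _
        ((htower τ₀ hτ₀ i hi.le _ (hSs i hi y' hy' idx)).1).symm ((htower τ₀ hτ₀ i hi.le _ (hSe i hi y' hy')).1).symm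
        (hH i hi y' hy' idx) (hsize i hi.le _ (hSs i hi y' hy' idx)) (hsize i hi.le _ (hSe i hi y' hy')) (by linarith) (by linarith)
    have hval := (analyticAt_effGauge_line_local W κf hs h0 μ ν τ₀ k S hSe hSs hdisc k le_rfl y hy).1
    have htop : ‖((κf (μ + τ₀ • ν) k y : 𝔸ˣ) : 𝔸) - 1‖ < 1 := by
      rw [← (htower τ₀ hτ₀ k le_rfl y hy).1]
      have h4 : ‖mlog ((κf (μ + τ₀ • ν) k y : 𝔸ˣ) : 𝔸)‖ + ‖(0 : 𝔸)‖ ≤ 1 / 4 := by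
        rw [norm_zero, add_zero]; linarith [hsize k le_rfl y hy]
      simpa only [exp_zero, mul_one] using norm_expMul_sub_one_lt_one h4
    have hlog : AnalyticAt ℂ (fun τ : ℂ => mlog ((κf (μ + τ • ν) k y : 𝔸ˣ) : 𝔸)) τ₀ :=
      (MatrixLog.analyticAt_mlog htop).fun_comp_of_eq hval rfl
    have hlinpart : AnalyticAt ℂ (fun τ : ℂ => siteAvgIter k (μ + τ • ν) y) τ₀ := by
      have : (fun τ : ℂ => siteAvgIter k (μ + τ • ν) y) = fun τ => siteAvgIter k μ y + τ • siteAvgIter k ν y := by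
        funext τ; rw [siteAvgIter_add_smul μ ν τ k]; rfl
      rw [this]
      exact analyticAt_const.add (analyticAt_id.smul analyticAt_const)
    exact (hlog.sub hlinpart).differentiableAt.differentiableWithinAt
  -- Cauchy ⇒ Lipschitz between `τ = 1` and `τ = 0`
  have hR4 : 4 ≤ R := by rw [hR, le_div_iff₀ hnpos]; linarith
  have h1 : (1 : ℂ) ∈ ball (0 : ℂ) (R / 2) := by rw [mem_ball, dist_zero_right, norm_one]; linarith
  have h0' : (0 : ℂ) ∈ ball (0 : ℂ) (R / 2) := mem_ball_self (by linarith)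
  have hlip := norm_sub_le_of_bound_on_ball hRpos hdiff hbound h1 h0'
  have hg1 : g 1 = mlog ((κf (μ + ν) k y : 𝔸ˣ) : 𝔸) - siteAvgIter k (μ + ν) y := by rw [hg]; simp only [one_smul]
  have hg0 : g 0 = mlog ((κf μ k y : 𝔸ˣ) : 𝔸) - siteAvgIter k μ y := by rw [hg]; simp only [zero_smul, add_zero]
  rw [← hg1, ← hg0]
  calc ‖g 1 - g 0‖ ≤ 2 * M / R * ‖(1 : ℂ) - 0‖ := hlip
    _ = 2 * M * n / r := by rw [sub_zero, norm_one, mul_one, hR]; field_simp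


end Lipschitz

end Summit.QuantumFields.YangMills.Theorems.P1FlatCoreFrameLinLipschitzLocal

end
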